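import Summits.HodgeConjecture.CorCM.TwoSheetDegenerate
import Summits.HodgeConjecture.CorCM.GaloisCyclicSemidirectEightNondegenerate
import Summits.HodgeConjecture.CorCM.GaloisAnnihilatorCertificates
import HarnessLib

/-!
# `C_p ⋊ C₈`: a SINGULAR odd two-sheet block certifies a simple DEGENERATE CM abelian `4p`-fold

COR-CM (cell `pub-hodgecm2`), binder seat b04 (gen 28), count-neutral claim CYCLIC-SEMIDIRECT-EIGHT-DEGENERATE, part II — the BAD
side of the dichotomy of `CorCM/GaloisCyclicSemidirectEightNondegenerate` («`C_p ⋊ C₈` is GOOD iff `p ≡ 5 (mod 8)`», GOOD side proved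
there) as a CERTIFICATE FORMAT BY CHARACTER SUMS.  KERNEL ONLY: theorems; no definition, no named fact, no `sorry`.  `HC_CM` is neither
used nor claimed.

SETTING (as in `CorCM/GaloisCyclicSemidirectEightTwoSheet`).  `G₀ = C_p ⋊ C₈ = Multiplicative (ZMod p) ⋊[φ] Multiplicative (ZMod 8)`,
`φ(1)` = inversion, `p` an odd prime; complex conjugation `c₀ = inr 4`; the abelian subgroup of index two `A = ℤ/4 × ℤ/p ↪ G₀`,
`i(t, v) = ⟨v, 2t⟩`, second sheet `i(A)·y`, `y = inr 1`, so that `i(t,v) y = ⟨v, 2t+1⟩`; `θ(t, v) = (t, v⁻¹)`, `y² = i(1, 0)`.  For a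
finite `S ⊆ G₀` with sheets `S₁ = {(t,v) | ⟨v,2t⟩ ∈ S}`, `S₂ = {(t,v) | ⟨v,2t+1⟩ ∈ S}` and a character `χ` of `A` the two-sheet
determinant is `Δ(χ) = Ŝ₁(χ)Ŝ₁(χθ) − χ(1,0)·Ŝ₂(χ)Ŝ₂(χθ)`.

* §1 **`exists_annihilator_of_singular_block`** (model): an ODD character `χ` (`χ(2,0) = −1`) with `Δ(χ) = 0` yields a NON-ZERO
  `c₀`-antisymmetric `b : G₀ → ℚ` annihilated by every right translate of `S` — part I (`TwoSheet.exists_annihilator_of_det_eq_zero`)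
  on the explicit two-sheet structure of `C_p ⋊ C₈`.
* §2 **`exists_simple_degenerate_of_singular_block`** (Galois dress): `e : Gal(K/ℚ) ≃* G₀`, `S` a CM set for `c₀` with trivial left
  stabiliser and a singular odd block ⟹ a PRIMITIVE DEGENERATE CM type of `K`, realised by a SIMPLE CM abelian variety of dimension
  `4p` with a rational `(q,q)` class outside the divisor ring on some power (gen 20's annihilator criterion
  `GaloisRank.isNondegenerate_iff_forall_annihilator` + `GaloisTable.exists_isPrimitive_of_tableModel`).  This replaces the LLL-found
  balanced sets of the `decide` certificates (`C₇, C₁₁, C₁₇, C₁₉, C₂₃ ⋊ C₈`) by ONE character-sum identity on `ℤ/p`; part III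
  (`CorCM/GaloisCyclicSemidirectEightDifferencePairs`) feeds it with DIFFERENCE PAIRS.
* §3 bookkeeping for part III: `eq_empty_or_eq_univ_of_forall_mem_iff_add_mem` (a translation-stable subset of `ℤ/p` is `∅`
  or everything) and the `decide`d facts `pairPred_*` about the sheet predicate
  `P(a,b,s) := (s ∈ {0,2} ∧ ¬a) ∨ (s ∈ {4,6} ∧ a) ∨ (s = 1 ∧ ¬b) ∨ s = 3 ∨ (s = 5 ∧ b)` on `Bool × Bool × ℤ/8`, by which
  `⟨v, s⟩ ∈ T(S, S′)` iff `P([v ∈ S], [v ∈ S′], s)`.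

## References

* [Kubota1965] T. Kubota, *On the field extension by complex multiplication*, Trans. AMS 118 (1965), §2, §4 Lemma 2.
* [Dodson1984] B. Dodson, *The structure of Galois groups of CM-fields*, Trans. AMS 283 (1984), §5.3.
* [Shimura1998] G. Shimura, *Abelian Varieties with Complex Multiplication and Modular Functions*, §6.2 Thm. 3, §8.2 Prop. 26.
* [Gordon1999HodgeAVSurvey] B. B. Gordon, *A survey of the Hodge conjecture for abelian varieties*, Thm. 6.4, §9.3, Prop. 9.4.1.
-/

noncomputable section

open CategoryTheory CategoryTheory.Limits NumberField
open scoped BigOperators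

namespace Summit.HodgeConjecture.CorCM.GaloisCyclicSemidirectEight

open Literature.NumberTheory.ComplexMultiplication
open Literature.AlgebraicGeometry.Motives (AbelianVariety CMType)
open Literature.AlgebraicGeometry.HodgeTheory
open Literature.AlgebraicGeometry.ComplexMultiplication (IsCMTypeRealisation)
open Literature.AlgebraicGeometry.Pohlmann1968
open Literature.Barriers.HodgeConjecture (divisorClassesSpan)
open Summit.HodgeConjecture.CorCM.GaloisRank
open Summit.HodgeConjecture.CorCM.AbelianSixteen (exists_simple_realisation_of_isPrimitive)
open AddChar

/-! ## §1 The model: a singular odd block gives a non-zero rational annihilator -/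

section Model

variable {p : ℕ} [NeZero p]

/-- **A SINGULAR ODD BLOCK OF `C_p ⋊ C₈` GIVES A NON-ZERO RATIONAL ANNIHILATOR.**  `φ(1)` = inversion; `S ⊆ G₀` any finite set
with sheets `S₁ = {(t,v) | ⟨v, 2t⟩ ∈ S}`, `S₂ = {(t,v) | ⟨v, 2t⟩·y ∈ S}` (`y = inr 1`) on `A = ℤ/4 × ℤ/p`; if an odd character `χ`
of `A` (`χ(2, 0) = −1`) has `Ŝ₁(χ)Ŝ₁(χθ) − χ(1,0)·Ŝ₂(χ)Ŝ₂(χθ) = 0` (`θ(t,v) = (t,v⁻¹)`), then some non-zero `b : G₀ → ℚ` with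
`b(inr 4 · g) = −b(g)` satisfies `Σ_{s∈S} b(s g) = 0` for every `g`. [cite: Kubota1965, §4 Lemma 2] [cite: Dodson1984, §5.3] -/
theorem exists_annihilator_of_singular_block
    (φ : Multiplicative (ZMod 8) →* MulAut (Multiplicative (ZMod p)))
    (hφ : ∀ v : Multiplicative (ZMod p), φ (Multiplicative.ofAdd 1) v = v⁻¹)
    (S : Finset (Multiplicative (ZMod p) ⋊[φ] Multiplicative (ZMod 8)))
    (S₁ S₂ : Finset (Multiplicative (ZMod 4) × Multiplicative (ZMod p)))
    (hS₁ : ∀ w, w ∈ S₁ ↔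
      (⟨w.2, Multiplicative.ofAdd (2 : ZMod 8) ^ (Multiplicative.toAdd w.1).val⟩ :
        Multiplicative (ZMod p) ⋊[φ] Multiplicative (ZMod 8)) ∈ S)
    (hS₂ : ∀ w, w ∈ S₂ ↔
      (⟨w.2, Multiplicative.ofAdd (2 : ZMod 8) ^ (Multiplicative.toAdd w.1).val⟩ :
        Multiplicative (ZMod p) ⋊[φ] Multiplicative (ZMod 8)) *
          SemidirectProduct.inr (Multiplicative.ofAdd (1 : ZMod 8)) ∈ S)
    (χ : AddChar (Additive (Multiplicative (ZMod 4) × Multiplicative (ZMod p))) ℂ)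
    (hχ : χ (Additive.ofMul (Multiplicative.ofAdd (2 : ZMod 4), (1 : Multiplicative (ZMod p)))) = -1)
    (hΔ : (∑ s ∈ S₁, χ (Additive.ofMul s)) * (∑ s ∈ S₁, χ (Additive.ofMul (s.1, s.2⁻¹))) -
      χ (Additive.ofMul (Multiplicative.ofAdd (1 : ZMod 4), (1 : Multiplicative (ZMod p)))) *
        ((∑ t ∈ S₂, χ (Additive.ofMul t)) * (∑ t ∈ S₂, χ (Additive.ofMul (t.1, t.2⁻¹)))) = 0) :
    ∃ b : Multiplicative (ZMod p) ⋊[φ] Multiplicative (ZMod 8) → ℚ, b ≠ 0 ∧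
      (∀ g, b (SemidirectProduct.inr (Multiplicative.ofAdd (4 : ZMod 8)) * g) = -b g) ∧
      ∀ g, ∑ s ∈ S, b (s * g) = 0 := by
  classical
  haveI : Fintype (Multiplicative (ZMod p) ⋊[φ] Multiplicative (ZMod 8)) :=
    Fintype.ofEquiv _ SemidirectProduct.equivProd.symm
  -- `2 ∈ ℤ/8` has order `4`
  have h24 : Multiplicative.ofAdd (2 : ZMod 8) ^ 4 = 1 := by
    rw [← ofAdd_nsmul]; decide
  -- the abelian subgroup `⟨y²⟩ × ⟨u⟩ ≅ ℤ/4 × ℤ/p`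
  let f : Multiplicative (ZMod 4) × Multiplicative (ZMod p) → Multiplicative (ZMod p) ⋊[φ] Multiplicative (ZMod 8) :=
    fun w => ⟨w.2, Multiplicative.ofAdd (2 : ZMod 8) ^ (Multiplicative.toAdd w.1).val⟩
  have hf_apply : ∀ w, f w = ⟨w.2, Multiplicative.ofAdd (2 : ZMod 8) ^ (Multiplicative.toAdd w.1).val⟩ :=
    fun w => rfl
  let i : Multiplicative (ZMod 4) × Multiplicative (ZMod p) →* Multiplicative (ZMod p) ⋊[φ] Multiplicative (ZMod 8) :=
    MonoidHom.mk' f fun w w' => by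
      refine SemidirectProduct.ext ?_ ?_
      · simp only [hf_apply, SemidirectProduct.mul_left, Prod.snd_mul, phi_two_pow φ hφ]
      · simp only [hf_apply, SemidirectProduct.mul_right, Prod.fst_mul, toAdd_mul, ← pow_add]
        rw [ZMod.val_add, ← pow_eq_pow_mod _ h24]
  have hi_apply : ∀ w, i w = ⟨w.2, Multiplicative.ofAdd (2 : ZMod 8) ^ (Multiplicative.toAdd w.1).val⟩ :=
    fun w => rfl
  -- powers of `2 ∈ ℤ/8` with exponent `< 4` are injective and never `1 ∈ ℤ/8`
  have hval4 : ∀ t : Multiplicative (ZMod 4), (Multiplicative.toAdd t).val < 4 := fun t => ZMod.val_lt _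
  have hpow2 : ∀ k : ℕ, Multiplicative.ofAdd (2 : ZMod 8) ^ k = Multiplicative.ofAdd ((2 * k : ℕ) : ZMod 8) :=
    fun k => by rw [← ofAdd_nsmul, nsmul_eq_mul, Nat.cast_mul, Nat.cast_ofNat, mul_comm]
  have hinj2 : ∀ k k' : ℕ, k < 4 → k' < 4 →
      Multiplicative.ofAdd (2 : ZMod 8) ^ k = Multiplicative.ofAdd (2 : ZMod 8) ^ k' → k = k' := by
    intro k k' hk hk' h
    rw [hpow2, hpow2, Equiv.apply_eq_iff_eq, ZMod.natCast_eq_natCast_iff'] at h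
    omega
  have hne1 : ∀ k : ℕ, Multiplicative.ofAdd (2 : ZMod 8) ^ k ≠ Multiplicative.ofAdd 1 := by
    intro k h
    rw [hpow2, Equiv.apply_eq_iff_eq, show (1 : ZMod 8) = ((1 : ℕ) : ZMod 8) by norm_num,
      ZMod.natCast_eq_natCast_iff'] at h
    omega
  have hi : Function.Injective i := by
    rintro ⟨t, v⟩ ⟨t', v'⟩ h
    rw [hi_apply, hi_apply, SemidirectProduct.ext_iff] at h
    refine Prod.ext ?_ h.1
    have := hinj2 _ _ (hval4 t) (hval4 t') h.2
    exact Multiplicative.toAdd.injective (ZMod.val_injective _ this)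
  -- the second sheet `i(A) · y`, `y = inr 1`
  set y : Multiplicative (ZMod p) ⋊[φ] Multiplicative (ZMod 8) :=
    SemidirectProduct.inr (Multiplicative.ofAdd (1 : ZMod 8)) with hy_def
  have hy : y = ⟨1, Multiplicative.ofAdd 1⟩ := rfl
  have hx : ∀ w, i w ≠ y := fun ⟨t, v⟩ h => by
    rw [hi_apply, hy, SemidirectProduct.ext_iff] at h
    exact hne1 _ h.2
  have hcov : ∀ g : Multiplicative (ZMod p) ⋊[φ] Multiplicative (ZMod 8), (∃ w, g = i w) ∨ (∃ w, g = i w * y) := by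
    rintro ⟨v, m⟩
    set n : ℕ := (Multiplicative.toAdd m).val with hn_def
    have hn8 : n < 8 := ZMod.val_lt _
    have hk4 : ((n / 2 : ℕ) : ZMod 4).val = n / 2 := ZMod.val_natCast_of_lt (by omega)
    have hm : m = Multiplicative.ofAdd (2 : ZMod 8) ^ (n / 2) * Multiplicative.ofAdd (1 : ZMod 8) ^ (n % 2) := by
      rw [← ofAdd_nsmul, ← ofAdd_nsmul, ← ofAdd_add, nsmul_eq_mul, nsmul_eq_mul]
      conv_lhs => rw [← ofAdd_toAdd m, ← ZMod.natCast_zmod_val (Multiplicative.toAdd m)]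
      rw [← hn_def, ← Nat.div_add_mod n 2]
      congr 1
      have e : (2 * (n / 2) + n % 2) / 2 = n / 2 := by omega
      have e' : (2 * (n / 2) + n % 2) % 2 = n % 2 := by omega
      rw [e, e']
      push_cast
      ring
    rcases Nat.mod_two_eq_zero_or_one n with h0 | h1
    · refine Or.inl ⟨(Multiplicative.ofAdd ((n / 2 : ℕ) : ZMod 4), v), ?_⟩
      rw [hi_apply, toAdd_ofAdd, hk4, hm, h0, pow_zero, mul_one]
    · refine Or.inr ⟨(Multiplicative.ofAdd ((n / 2 : ℕ) : ZMod 4), v), ?_⟩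
      rw [hi_apply, toAdd_ofAdd, hk4, hy, SemidirectProduct.mul_def]
      refine SemidirectProduct.ext ?_ ?_
      · simp
      · simpa [h1] using hm
  -- conjugation by `y` inverts the `ℤ/p`-factor; `y² = i(1, 0)`
  let θ : Multiplicative (ZMod 4) × Multiplicative (ZMod p) ≃* Multiplicative (ZMod 4) × Multiplicative (ZMod p) :=
    MulEquiv.prodCongr (MulEquiv.refl _) (MulEquiv.inv _)
  have hθ_apply : ∀ w, θ w = (w.1, w.2⁻¹) := fun w => rfl
  have hθ : ∀ w, y * i w = i (θ w) * y := fun ⟨t, v⟩ => by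
    rw [hi_apply, hi_apply, hθ_apply, hy, SemidirectProduct.mul_def, SemidirectProduct.mul_def]
    refine SemidirectProduct.ext ?_ ?_
    · simp [hφ]
    · simp [mul_comm]
  set q : Multiplicative (ZMod 4) × Multiplicative (ZMod p) := (Multiplicative.ofAdd 1, 1) with hq_def
  have h1val : (1 : ZMod 4).val = 1 := by decide
  have hyy : y * y = i q := by
    rw [hi_apply, hq_def, toAdd_ofAdd, h1val, pow_one, hy, SemidirectProduct.mul_def]
    refine SemidirectProduct.ext ?_ ?_
    · simp
    · change Multiplicative.ofAdd (1 : ZMod 8) * Multiplicative.ofAdd 1 = Multiplicative.ofAdd 2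
      rw [← ofAdd_add]; norm_num
  set c : Multiplicative (ZMod 4) × Multiplicative (ZMod p) := (Multiplicative.ofAdd 2, 1) with hc_def
  have h2val : (2 : ZMod 4).val = 2 := by decide
  have hic : i c = SemidirectProduct.inr (Multiplicative.ofAdd (4 : ZMod 8)) := by
    rw [hi_apply, hc_def, toAdd_ofAdd, h2val, hpow2]
    rfl
  have hθc : θ c = c := by rw [hθ_apply, hc_def, inv_one]
  -- the sheets in terms of `i` and `y`
  have hS₁' : ∀ w, w ∈ S₁ ↔ i w ∈ S := fun w => by rw [hS₁, hi_apply]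
  have hS₂' : ∀ w, w ∈ S₂ ↔ i w * y ∈ S := fun w => by rw [hS₂, hi_apply]
  have hΔ' : (∑ s ∈ S₁, χ (Additive.ofMul s)) * (∑ s ∈ S₁, χ (Additive.ofMul (θ s))) -
      χ (Additive.ofMul q) * ((∑ t ∈ S₂, χ (Additive.ofMul t)) * (∑ t ∈ S₂, χ (Additive.ofMul (θ t)))) = 0 := by
    simp_rw [hθ_apply]
    exact hΔ
  obtain ⟨b, hb0, hb, hbann⟩ := TwoSheet.exists_annihilator_of_det_eq_zero i hi y hx hcov θ hθ q hyy hθc S S₁ S₂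
    hS₁' hS₂' χ hχ hΔ'
  exact ⟨b, hb0, fun g => by rw [← hic]; exact hb g, hbann⟩

end Model

/-! ## §2 The Galois dress: a simple DEGENERATE CM abelian `4p`-fold -/

section Field

variable {p : ℕ} [Fact p.Prime]
variable {K : Type} [Field K] [NumberField K] [IsCMField K] [IsGalois ℚ K]

/-- **SINGULAR-BLOCK CERTIFICATE ⟹ a simple DEGENERATE CM abelian `4p`-fold.**  `e : Gal(K/ℚ) ≃* C_p ⋊ C₈` (`φ(1)` = inversion,
`p` an odd prime), `S ⊆ G₀` a CM set for `c₀ = inr 4` (`c₀ g ∈ S ↔ g ∉ S`) with trivial left stabiliser, sheets `S₁, S₂` on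
`ℤ/4 × ℤ/p` as in §1, and an ODD character `χ` with a SINGULAR two-sheet block ⟹ `K` has a PRIMITIVE DEGENERATE CM type, realised
by a SIMPLE abelian variety of dimension `4p` with CM by `K` carrying a rational `(q,q)` class outside the divisor ring on some
power. [cite: Kubota1965, §2 and §4 Lemma 2] [cite: Shimura1998, §6.2 Thm. 3 and §8.2 Prop. 26]
[cite: Gordon1999HodgeAVSurvey, Thm. 6.4 and §9.3] -/
theorem exists_simple_degenerate_of_singular_block (hp2 : p ≠ 2)
    (φ : Multiplicative (ZMod 8) →* MulAut (Multiplicative (ZMod p)))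
    (hφ : ∀ v : Multiplicative (ZMod p), φ (Multiplicative.ofAdd 1) v = v⁻¹)
    (e : (K ≃ₐ[ℚ] K) ≃* Multiplicative (ZMod p) ⋊[φ] Multiplicative (ZMod 8))
    (S : Finset (Multiplicative (ZMod p) ⋊[φ] Multiplicative (ZMod 8)))
    (hScm : ∀ g, g ∈ S ↔ SemidirectProduct.inr (Multiplicative.ofAdd (4 : ZMod 8)) * g ∉ S)
    (hprim : ∀ g : Multiplicative (ZMod p) ⋊[φ] Multiplicative (ZMod 8), g ≠ 1 → ∃ w, ¬ (w ∈ S ↔ g * w ∈ S))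
    (S₁ S₂ : Finset (Multiplicative (ZMod 4) × Multiplicative (ZMod p)))
    (hS₁ : ∀ w, w ∈ S₁ ↔
      (⟨w.2, Multiplicative.ofAdd (2 : ZMod 8) ^ (Multiplicative.toAdd w.1).val⟩ :
        Multiplicative (ZMod p) ⋊[φ] Multiplicative (ZMod 8)) ∈ S)
    (hS₂ : ∀ w, w ∈ S₂ ↔
      (⟨w.2, Multiplicative.ofAdd (2 : ZMod 8) ^ (Multiplicative.toAdd w.1).val⟩ :
        Multiplicative (ZMod p) ⋊[φ] Multiplicative (ZMod 8)) *
          SemidirectProduct.inr (Multiplicative.ofAdd (1 : ZMod 8)) ∈ S)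
    (χ : AddChar (Additive (Multiplicative (ZMod 4) × Multiplicative (ZMod p))) ℂ)
    (hχ : χ (Additive.ofMul (Multiplicative.ofAdd (2 : ZMod 4), (1 : Multiplicative (ZMod p)))) = -1)
    (hΔ : (∑ s ∈ S₁, χ (Additive.ofMul s)) * (∑ s ∈ S₁, χ (Additive.ofMul (s.1, s.2⁻¹))) -
      χ (Additive.ofMul (Multiplicative.ofAdd (1 : ZMod 4), (1 : Multiplicative (ZMod p)))) *
        ((∑ t ∈ S₂, χ (Additive.ofMul t)) * (∑ t ∈ S₂, χ (Additive.ofMul (t.1, t.2⁻¹)))) = 0) :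
    ∃ (Φ : CMType K) (φ₀ : K →+* ℂ) (A : AbelianVariety ℂ) (ι : 𝓞 K →+* End A)
      (θ : K →+* Module.End ℂ (complexBetti A.X 1)),
      IsPrimitive (ℂ ≃+* ℂ) Φ.1 φ₀ ∧ ¬ IsNondegenerate Φ ∧ IsCMTypeRealisation Φ A ι θ ∧ A.IsSimple ∧ A.dim = 4 * p ∧
      ∃ n q : ℕ, ∃ x : complexBetti (⨁ fun _ : Fin n => A).X (2 * q), IsRationalClass x ∧
        IsOfHodgeType (⨁ fun _ : Fin n => A).dim (⨁ fun _ : Fin n => A).X (2 * q) q q x ∧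
        x ∉ divisorClassesSpan (⨁ fun _ : Fin n => A).X (⨁ fun _ : Fin n => A).dim q := by
  classical
  have hp : p.Prime := Fact.out
  haveI : NeZero p := ⟨hp.ne_zero⟩
  haveI : Fintype (Multiplicative (ZMod p) ⋊[φ] Multiplicative (ZMod 8)) :=
    Fintype.ofEquiv _ SemidirectProduct.equivProd.symm
  set c₀ : Multiplicative (ZMod p) ⋊[φ] Multiplicative (ZMod 8) :=
    SemidirectProduct.inr (Multiplicative.ofAdd (4 : ZMod 8)) with hc₀_def
  have hc : e ((IsCMField.complexConj K).restrictScalars ℚ) = c₀ := map_complexConj_eq φ hφ hp2 e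
  obtain ⟨φ₀⟩ := (inferInstance : Nonempty (K →+* ℂ))
  -- the primitive CM type read as `S`
  have hcm : ∀ g, g ∈ S ↔ c₀ * g ∉ S := hScm
  obtain ⟨Φ, hprimΦ, hread⟩ := GaloisTable.exists_isPrimitive_of_tableModel (K := K)
    (X := Multiplicative (ZMod p) ⋊[φ] Multiplicative (ZMod 8))
    (fun a b => a * b) e.toEquiv (fun _ _ => map_mul e _ _) c₀ hc 1 (map_one e) S hcm hprim φ₀
  have hS : ∀ y, y ∈ S ↔ embOf φ₀ (e.symm y) ∈ Φ.1 := fun y => hread y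
  -- degenerate, by the annihilator of §1
  obtain ⟨b, hb0, hb, hbann⟩ := exists_annihilator_of_singular_block φ hφ S S₁ S₂ hS₁ hS₂ χ hχ hΔ
  have hdeg : ¬ IsNondegenerate Φ := fun hnd =>
    hb0 ((isNondegenerate_iff_forall_annihilator e hc Φ φ₀ S hS).1 hnd b hb hbann)
  obtain ⟨A, ι, θ, hA, hs, hdim⟩ := exists_simple_realisation_of_isPrimitive Φ φ₀ hprimΦ
  refine ⟨Φ, φ₀, A, ι, θ, hprimΦ, hdeg, hA, hs, ?_, exists_exceptional_pow_of_not_isNondegenerate φ₀ hprimΦ hdeg hA⟩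
  rw [hdim, finrank_eq φ e, show 8 * p = 4 * p * 2 by ring, Nat.mul_div_cancel _ (by norm_num)]

end Field

/-! ## §3 Bookkeeping for part III: translation-stable subsets of `ℤ/p` and the sheet predicate on `ℤ/8` -/

/-- A subset of `ℤ/p` stable under a non-zero translation is empty or everything (the translation generates `ℤ/p`). [folklore] -/
theorem eq_empty_or_eq_univ_of_forall_mem_iff_add_mem {p : ℕ} [Fact p.Prime] (S : Finset (ZMod p)) {u : ZMod p}
    (hu : u ≠ 0) (h : ∀ v, v ∈ S ↔ u + v ∈ S) : S = ∅ ∨ S = Finset.univ := by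
  have key : ∀ (n : ℕ) (v : ZMod p), v ∈ S ↔ (n : ZMod p) * u + v ∈ S := by
    intro n
    induction n with
    | zero => intro v; simp
    | succ n ih =>
      intro v
      rw [ih, h, show u + ((n : ZMod p) * u + v) = ((n + 1 : ℕ) : ZMod p) * u + v by push_cast; ring]
  have hall : ∀ v w, v ∈ S ↔ w ∈ S := fun v w => by
    have := key ((w - v) * u⁻¹).val v
    rwa [ZMod.natCast_zmod_val, inv_mul_cancel_right₀ hu, sub_add_cancel] at this
  rcases S.eq_empty_or_nonempty with h0 | ⟨v, hv⟩
  · exact Or.inl h0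
  · exact Or.inr (Finset.eq_univ_iff_forall.2 fun w => (hall v w).1 hv)

/-! ### The sheet predicate of a difference pair

`⟨v, s⟩ ∈ T(S, S′)` iff `P(a, b, s)` with `a = [v ∈ S]`, `b = [v ∈ S′]` and
`P(a,b,s) := (s ∈ {0,2} ∧ ¬a) ∨ (s ∈ {4,6} ∧ a) ∨ (s = 1 ∧ ¬b) ∨ s = 3 ∨ (s = 5 ∧ b)`, written out in full below. -/

set_option synthInstance.maxSize 2048 in
/-- `P(a, b, 4 + s) ↔ ¬ P(a, b, s)`: `T(S, S′)` is a CM set for `c₀ = y⁴`. [folklore] -/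
theorem pairPred_four_add : ∀ (a b : Bool) (s : ZMod 8),
    ((4 + s = 0 ∨ 4 + s = 2) ∧ a = false ∨
        (4 + s = 4 ∨ 4 + s = 6) ∧ a = true ∨
        4 + s = 1 ∧ b = false ∨ 4 + s = 3 ∨
        4 + s = 5 ∧ b = true) ↔
      ¬ ((s = 0 ∨ s = 2) ∧ a = false ∨
          (s = 4 ∨ s = 6) ∧ a = true ∨
          s = 1 ∧ b = false ∨ s = 3 ∨
          s = 5 ∧ b = true) := by
  decide

set_option synthInstance.maxSize 2048 in
/-- `P(a, b, 0) ↔ ¬a`, and `P(a, b, 3)` always. [folklore] -/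
theorem pairPred_zero_three : ∀ (a b : Bool),
    ((((0 : ZMod 8) = 0 ∨ (0 : ZMod 8) = 2) ∧ a = false ∨
        ((0 : ZMod 8) = 4 ∨ (0 : ZMod 8) = 6) ∧ a = true ∨
        (0 : ZMod 8) = 1 ∧ b = false ∨ (0 : ZMod 8) = 3 ∨
        (0 : ZMod 8) = 5 ∧ b = true) ↔ a = false) ∧
    (((3 : ZMod 8) = 0 ∨ (3 : ZMod 8) = 2) ∧ a = false ∨
        ((3 : ZMod 8) = 4 ∨ (3 : ZMod 8) = 6) ∧ a = true ∨
        (3 : ZMod 8) = 1 ∧ b = false ∨ (3 : ZMod 8) = 3 ∨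
        (3 : ZMod 8) = 5 ∧ b = true) := by
  decide

set_option synthInstance.maxSize 2048 in
/-- The odd sheet three steps on: `P(a, b, σ + 3)` for odd `σ` is `a` (`σ ∈ {1,3}`) or `¬a` (`σ ∈ {5,7}`). [folklore] -/
theorem pairPred_odd_add_three : ∀ σ : ZMod 8, σ.val % 2 = 1 →
    (∀ a b : Bool, ((σ + 3 = 0 ∨ σ + 3 = 2) ∧ a = false ∨
        (σ + 3 = 4 ∨ σ + 3 = 6) ∧ a = true ∨
        σ + 3 = 1 ∧ b = false ∨ σ + 3 = 3 ∨
        σ + 3 = 5 ∧ b = true) ↔ a = true) ∨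
    (∀ a b : Bool, ((σ + 3 = 0 ∨ σ + 3 = 2) ∧ a = false ∨
        (σ + 3 = 4 ∨ σ + 3 = 6) ∧ a = true ∨
        σ + 3 = 1 ∧ b = false ∨ σ + 3 = 3 ∨
        σ + 3 = 5 ∧ b = true) ↔ a = false) := by
  decide

set_option synthInstance.maxSize 2048 in
/-- The even sheet: `P(a, b, σ)` for even `σ` is `¬a` (`σ ∈ {0,2}`) or `a` (`σ ∈ {4,6}`). [folklore] -/
theorem pairPred_even : ∀ σ : ZMod 8, σ.val % 2 = 0 →
    (∀ a b : Bool, ((σ = 0 ∨ σ = 2) ∧ a = false ∨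
        (σ = 4 ∨ σ = 6) ∧ a = true ∨
        σ = 1 ∧ b = false ∨ σ = 3 ∨
        σ = 5 ∧ b = true) ↔ a = false) ∨
    (∀ a b : Bool, ((σ = 0 ∨ σ = 2) ∧ a = false ∨
        (σ = 4 ∨ σ = 6) ∧ a = true ∨
        σ = 1 ∧ b = false ∨ σ = 3 ∨
        σ = 5 ∧ b = true) ↔ a = true) := by
  decide

set_option synthInstance.maxSize 2048 in
/-- Witness positions against an even `σ ≠ 0`: some `k` with `P(·,·,k) = ¬a` and `P(·,·,σ+k) = a`. [folklore] -/
theorem pairPred_even_witness : ∀ σ : ZMod 8, σ.val % 2 = 0 → σ ≠ 0 → ∃ k : ZMod 8,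
    (∀ a b : Bool, ((k = 0 ∨ k = 2) ∧ a = false ∨
        (k = 4 ∨ k = 6) ∧ a = true ∨
        k = 1 ∧ b = false ∨ k = 3 ∨
        k = 5 ∧ b = true) ↔ a = false) ∧
    (∀ a b : Bool, ((σ + k = 0 ∨ σ + k = 2) ∧ a = false ∨
        (σ + k = 4 ∨ σ + k = 6) ∧ a = true ∨
        σ + k = 1 ∧ b = false ∨ σ + k = 3 ∨
        σ + k = 5 ∧ b = true) ↔ a = true) := by
  decide

set_option synthInstance.maxSize 2048 in
/-- The sheets read on `ℤ/4`: `P(a, b, 2t)` and `P(a, b, 2t+1)`. [folklore] -/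
theorem pairPred_sheets : ∀ (t : ZMod 4) (a b : Bool),
    (((((2 * t.val : ℕ) : ZMod 8) = 0 ∨ ((2 * t.val : ℕ) : ZMod 8) = 2) ∧ a = false ∨
        (((2 * t.val : ℕ) : ZMod 8) = 4 ∨ ((2 * t.val : ℕ) : ZMod 8) = 6) ∧ a = true ∨
        ((2 * t.val : ℕ) : ZMod 8) = 1 ∧ b = false ∨ ((2 * t.val : ℕ) : ZMod 8) = 3 ∨
        ((2 * t.val : ℕ) : ZMod 8) = 5 ∧ b = true) ↔
      (t = 0 ∨ t = 1) ∧ a = false ∨ (t = 2 ∨ t = 3) ∧ a = true) ∧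
    (((((2 * t.val + 1 : ℕ) : ZMod 8) = 0 ∨ ((2 * t.val + 1 : ℕ) : ZMod 8) = 2) ∧ a = false ∨
        (((2 * t.val + 1 : ℕ) : ZMod 8) = 4 ∨ ((2 * t.val + 1 : ℕ) : ZMod 8) = 6) ∧ a = true ∨
        ((2 * t.val + 1 : ℕ) : ZMod 8) = 1 ∧ b = false ∨ ((2 * t.val + 1 : ℕ) : ZMod 8) = 3 ∨
        ((2 * t.val + 1 : ℕ) : ZMod 8) = 5 ∧ b = true) ↔
      t = 0 ∧ b = false ∨ t = 1 ∨ t = 2 ∧ b = true) := by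
  decide

end Summit.HodgeConjecture.CorCM.GaloisCyclicSemidirectEight

end
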